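import Literature.NumberTheory.EllipticCurves.RingClassFieldClassNumber
import Literature.NumberTheory.NumberFields.RingClassFieldAbelian
import Literature.NumberTheory.EllipticCurves.TwistedHeegnerFamilyExistence
import Literature.NumberTheory.EllipticCurves.ZpExtension
import Literature.NumberTheory.GaloisRepresentations.ArtinRestriction
import Literature.NumberTheory.QuadraticFields.RingClassGenusCharacterTriviality
import HarnessLib

/-!
# The anticyclotomic tower clause `K_k ⊆ K[c]` from a splitting statement (Bauer + the `jbar`-transfer)

Topic `NumberTheory/EllipticCurves` (complex multiplication / class field theory of imaginary quadratic
fields). THEOREMS ONLY — no definition, no named fact (net Literature debt `0`); unconditional.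
Cell `bsd-print-x9` (D-0154 row 10), seat `bsd-line-x10b-p1` LEAD (line «twins» on the crux
`PrintX10b.BeyondCarrierDepthX10b`, stmt-BirchSwinnertonDyer-23055): the END PIECE of the registered stub
`stub_anticyclotomicTowerSharp` (= the routes' support item `AnticyclotomicTowerSharp`, "Tower♯":
`Gal(K̄/K[p^{k+1}]) ≤ Gal(K̄/K_k)` for the anticyclotomic `ℤ_p`-extension of an imaginary quadratic `K`).

The tree's `ringClassSubgroup K c jbar ≤ Γ_K` (`HeegnerModuleIndex`) is CUT OUT BY `jbar : K̄ → ℂ` and the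
singular moduli of discriminant `c²d_K`, whereas class field theory (`RingClassFieldClassNumber`:
Cox Thm. 11.1 with §9.A, `exists_classField_algEquiv_ringClassField`) produces the ring class field as an
abstract finite Galois `R ⊆ K̄` with a splitting law and SOME `K`-isomorphism `R ≃ K[c]`. This file is the
dictionary between the two and the resulting reduction of Tower♯ to a SPLITTING STATEMENT about the layer
`K_k = κ.layer k`:

* §1 `apply_mem_ringClassField_of_algEquiv`, `exists_mem_apply_eq_of_mem_ringClassField_of_algEquiv` —
  for EVERY finite Galois `R ⊆ K̄` with `R ≃ₐ[K] K[c]` (`K[c] = ringClassField K ι c ⊂ ℂ`, `ι = jbar ∘ (K → K̄)`):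
  `jbar(R) = K[c]` (normality of `K[c]/K`: a `K`-embedding of `K[c]` into `ℂ` has range `K[c]`,
  Mathlib `AlgHom.fieldRange_of_normal`); hence
  `mem_ringClassSubgroup_iff_forall_smul_eq` — **`σ ∈ ringClassSubgroup K c jbar ↔ σ` fixes `R` pointwise**,
  i.e. `ringClassSubgroup K c jbar = Gal(K̄/R)` (`ringClassSubgroup_eq_comap_fixingSubgroup`): the ring class
  subgroup is the fixing subgroup of the class field, independently of `jbar`.
* §2 `ZpExtension.layer_le_of_splitPrimes` — BAUER (Neukirch VII (13.9), the tree's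
  `le_of_splitPrimes_subset_algClosure`): if all but finitely many primes `v` of `K` with trivial ring class
  `[𝔭_v] = 1 ∈ I_K(c)/P_{K,ℤ}(c)` split completely in `K_k`, then `K_k ⊆ R` for the class field `R` of
  conductor `c` (splitting law `v ∈ splitPrimes K R ↔ [𝔭_v] = 1`, Cox Thm. 9.2).
* §3 **`ringClassSubgroup_le_layerSubgroup_of_splitPrimes`** — hence `Gal(K̄/K[c]) ≤ Gal(K̄/K_k)`, i.e.
  `K_k ⊆ K[c]`, from that splitting statement alone (Krull–Galois for the open subgroup `κ⁻¹(p^kℤ_p)`,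
  `ZpExtension.fixingSubgroup_layer`); also in the principal-generator currency
  (`…_of_principal_splits`: the primes `𝔭_v = (α)`, `α ≡ n (mod c)`, `n ∈ ℤ` coprime to `c`, split in `K_k`;
  `RingClass.exists_generator_of_primeClass_eq_one`); §4 `anticyclotomicTowerSharp_of_forall_splitPrimes` — the letter of
  Tower♯ (`c = p^{k+1}`, all `K`, odd `p`, anticyclotomic `κ`) from the corresponding family of splitting
  statements (to be supplied by the idèlic computation `κ(Frob_v) ∈ p^kℤ_p` for `𝔭_v = (α)`,
  `α ≡ a (mod p^{k+1})`, `a ∈ ℤ` — Cox Thm. 7.24 / Perrin-Riou 1987 §3.2; NOT proved here).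

* §5 (appended after Tower♯ closed): `ringClassSubgroup_eq_of_embeddings` — `ringClassSubgroup K c jbar` does not depend on
  `jbar`; `ringClassSubgroup_eq_comap_fixingSubgroup_of_splitPrimes_iff` / `mem_ringClassSubgroup_iff_forall_smul_eq_of_splitPrimes_iff`
  — it is the fixing subgroup of THE class field of conductor `c` given only by its splitting law (uniqueness, Neukirch VII (13.10),
  `RingClassField.eq_of_splitPrimes_iff_primeClass_eq_one`).

HONEST FRAMING: classical Galois theory + the tree's class field theory of `K[c]`; nothing on elliptic
curves, `L`-functions or BSD is asserted; Tower♯ itself is NOT proved in this file (only reduced).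

## Mathlib / tree search

Tree: `exists_classField_algEquiv_ringClassField`, `finiteDimensional_and_isGalois_ringClassField`,
`apply_mem_ringClassField` (`RingClassFieldClassNumber`, `HeegnerPointsOfConductor`);
`smul_eq_self_of_mem_ringClassSubgroup`, `mem_range_of_mem_ringClassField` (`TwistedHeegnerFamilyExistence`);
`le_of_splitPrimes_subset_algClosure` (`NumberFields/RingClassFieldAbelian`); `finite_setOf_le_asIdeal`
(`NumberFields/RayClassFieldOfCharacter`); `ZpExtension.layer`, `fixingSubgroup_layer`,
`finiteDimensional_layer_holds`, `isGalois_layer_holds` (`ZpExtension`); `mem_fixingSubgroup_iff_forall_smul`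
(`GaloisRepresentations/ArtinRestriction`). Mathlib: `AlgHom.fieldRange_of_normal`, `Normal.of_algEquiv`, `Subfield.toIntermediateField`, `Subgroup.mem_map_equiv`.

## References

* D. A. Cox, *Primes of the form x² + ny²*, 2nd ed., Wiley 2013: §7.D Thm. 7.24; §9.A Thm. 9.2; §11.A Thm. 11.1. [Cox2013]
* J. Neukirch, *Algebraic Number Theory*, Springer 1999: Ch. VII §13 Prop. (13.9) (Bauer). [NeukirchANT1999]
* B. Perrin-Riou, *Fonctions L p-adiques, théorie d'Iwasawa et points de Heegner*, Bull. SMF 115 (1987), §3.2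
  (`K_∞ ⊂ ∪ₙ K[p^n]`). [PerrinRiou1987BSMF]
* F. Castella, G. Grossi, J. Lee, C. Skinner, *On the anticyclotomic Iwasawa theory of rational elliptic curves
  at Eisenstein primes*, Invent. Math. 227 (2022), §4.1 (`K_k ⊂ K[p^{d(k)}]`). [CastellaGrossiLeeSkinner2022]
-/

set_option autoImplicit false

noncomputable section

open scoped Classical

open IsDedekindDomain NumberField

namespace Literature.NumberTheory.EllipticCurves

open Literature.NumberTheory.GaloisRepresentations
open Literature.NumberTheory.NumberFields Literature.NumberTheory.NumberFields.RingClassField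
open Literature.NumberTheory.QuadraticFields.RingClass (exists_generator_of_primeClass_eq_one)

variable {K : Type} [Field K] [NumberField K]

/-! ## §1 `jbar(R) = K[c]` for every class-field copy `R ≅ K[c]` inside `K̄`; `ringClassSubgroup = Gal(K̄/R)` -/

/-- **`jbar` maps every `K`-isomorphic copy `R ⊆ K̄` of `K[c]` INTO `K[c] ⊂ ℂ`** (`K` imaginary quadratic,
`c ≠ 0`, `K[c] = ringClassField K ι c` with `ι = jbar ∘ (K → K̄)`): `K[c]/K` is Galois
(`finiteDimensional_and_isGalois_ringClassField`), so the `K`-embedding `jbar|_R ∘ (K[c] ≃ R)` of `K[c]` into `ℂ`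
has range inside `K[c]` (normality, `AlgHom.fieldRange_of_normal`).
[cite: Cox2013, §11.A Thm. 11.1 and §9.A (K[c]/K Galois)] -/
theorem apply_mem_ringClassField_of_algEquiv (hK : IsImaginaryQuadratic K)
    (jbar : AlgebraicClosure K →+* ℂ) {c : ℕ} (hc : c ≠ 0)
    {R : IntermediateField K (AlgebraicClosure K)}
    (e : R ≃ₐ[K] ringClassField K (jbar.comp (algebraMap K (AlgebraicClosure K))) c)
    {x : AlgebraicClosure K} (hx : x ∈ R) :
    jbar x ∈ ringClassField K (jbar.comp (algebraMap K (AlgebraicClosure K))) c := by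
  set ι : K →+* ℂ := jbar.comp (algebraMap K (AlgebraicClosure K)) with hι
  letI : Algebra K ℂ := ι.toAlgebra
  -- `K[c]` as an intermediate field of `ℂ/K` (through `ι`), and the identity `K[c] ≃ₐ[K] E`
  let E : IntermediateField K ℂ :=
    (ringClassField K ι c).toIntermediateField fun k ↦ apply_mem_ringClassField ι c k
  let e₀ : ringClassField K ι c ≃ₐ[K] E :=
    { toFun := fun y ↦ ⟨y.1, y.2⟩
      invFun := fun y ↦ ⟨y.1, y.2⟩
      left_inv := fun _ ↦ rfl
      right_inv := fun _ ↦ rfl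
      map_mul' := fun _ _ ↦ rfl
      map_add' := fun _ _ ↦ rfl
      commutes' := fun _ ↦ rfl }
  haveI := (finiteDimensional_and_isGalois_ringClassField hK ι hc).2
  haveI : Normal K E := Normal.of_algEquiv e₀
  -- `jbar` as a `K`-algebra map and the induced embedding `ψ : E → ℂ`
  let jbarₐ : AlgebraicClosure K →ₐ[K] ℂ := { jbar with commutes' := fun _ ↦ rfl }
  let ψ : E →ₐ[K] ℂ := (jbarₐ.comp R.val).comp ((e.trans e₀).symm : E →ₐ[K] R)
  have hψ : ψ.fieldRange ≤ E := (AlgHom.fieldRange_of_normal ψ).le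
  have hxψ : ψ ((e.trans e₀) ⟨x, hx⟩) = jbar x := by
    show jbarₐ (R.val ((e.trans e₀).symm ((e.trans e₀) ⟨x, hx⟩))) = jbar x
    rw [AlgEquiv.symm_apply_apply]
    rfl
  have hmem : jbar x ∈ E := by
    rw [← hxψ]
    exact hψ ⟨_, rfl⟩
  exact hmem

/-- **… and ONTO `K[c]`**: every element of `K[c] ⊂ ℂ` is the `jbar`-image of an element of any
`K`-isomorphic copy `R ⊆ K̄` of `K[c]` (`AlgHom.fieldRange_of_normal`: a `K`-embedding of the normal
extension `K[c]` into `ℂ` has range exactly `K[c]`). Together with `apply_mem_ringClassField_of_algEquiv`: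
`jbar(R) = K[c]`. [cite: Cox2013, §11.A Thm. 11.1 and §9.A (K[c]/K Galois)] -/
theorem exists_mem_apply_eq_of_mem_ringClassField_of_algEquiv (hK : IsImaginaryQuadratic K)
    (jbar : AlgebraicClosure K →+* ℂ) {c : ℕ} (hc : c ≠ 0)
    {R : IntermediateField K (AlgebraicClosure K)}
    (e : R ≃ₐ[K] ringClassField K (jbar.comp (algebraMap K (AlgebraicClosure K))) c)
    {y : ℂ} (hy : y ∈ ringClassField K (jbar.comp (algebraMap K (AlgebraicClosure K))) c) :
    ∃ x ∈ R, jbar x = y := by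
  set ι : K →+* ℂ := jbar.comp (algebraMap K (AlgebraicClosure K)) with hι
  letI : Algebra K ℂ := ι.toAlgebra
  let E : IntermediateField K ℂ :=
    (ringClassField K ι c).toIntermediateField fun k ↦ apply_mem_ringClassField ι c k
  let e₀ : ringClassField K ι c ≃ₐ[K] E :=
    { toFun := fun y ↦ ⟨y.1, y.2⟩
      invFun := fun y ↦ ⟨y.1, y.2⟩
      left_inv := fun _ ↦ rfl
      right_inv := fun _ ↦ rfl
      map_mul' := fun _ _ ↦ rfl
      map_add' := fun _ _ ↦ rfl
      commutes' := fun _ ↦ rfl }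
  haveI := (finiteDimensional_and_isGalois_ringClassField hK ι hc).2
  haveI : Normal K E := Normal.of_algEquiv e₀
  let jbarₐ : AlgebraicClosure K →ₐ[K] ℂ := { jbar with commutes' := fun _ ↦ rfl }
  let ψ : E →ₐ[K] ℂ := (jbarₐ.comp R.val).comp ((e.trans e₀).symm : E →ₐ[K] R)
  have hψ : ψ.fieldRange = E := AlgHom.fieldRange_of_normal ψ
  have hyE : y ∈ ψ.fieldRange := by
    rw [hψ]
    exact hy
  obtain ⟨z, hz⟩ := hyE
  refine ⟨((e.trans e₀).symm z : R), ((e.trans e₀).symm z).2, ?_⟩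
  rw [← hz]
  rfl

/-- **`Gal(K̄/K[c])` fixes every class-field copy `R ≅ K[c]` inside `K̄` pointwise**: for
`σ ∈ ringClassSubgroup K c jbar` and `x ∈ R`, `σ • x = x` (`jbar x ∈ K[c]` by
`apply_mem_ringClassField_of_algEquiv`, and `Gal(K̄/K[c])` fixes the `jbar`-preimage of `K[c]`,
`smul_eq_self_of_mem_ringClassSubgroup`). [cite: Cox2013, §11.A Thm. 11.1] -/
theorem smul_eq_self_of_mem_ringClassSubgroup_of_algEquiv (hK : IsImaginaryQuadratic K)
    (jbar : AlgebraicClosure K →+* ℂ) {c : ℕ} (hc : c ≠ 0)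
    {R : IntermediateField K (AlgebraicClosure K)}
    (e : R ≃ₐ[K] ringClassField K (jbar.comp (algebraMap K (AlgebraicClosure K))) c)
    {σ : Field.absoluteGaloisGroup K} (hσ : σ ∈ ringClassSubgroup K c jbar)
    {x : AlgebraicClosure K} (hx : x ∈ R) : σ • x = x :=
  smul_eq_self_of_mem_ringClassSubgroup hK jbar hc hσ (apply_mem_ringClassField_of_algEquiv hK jbar hc e hx)

/-- **`ringClassSubgroup K c jbar = Gal(K̄/R)` for every class-field copy `R ≅ K[c]` inside `K̄`**:
`σ ∈ Γ_K` lies in the ring class subgroup of conductor `c` iff it fixes `R` pointwise. (`→`: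
`smul_eq_self_of_mem_ringClassSubgroup_of_algEquiv`. `←`: a `jbar`-preimage `a` of a singular modulus of
discriminant `c²d_K` — these lie in `K[c]`, `ringClassSingularModuli_subset_ringClassField` — is `jbar x`
for some `x ∈ R` (`exists_mem_apply_eq_of_mem_ringClassField_of_algEquiv`), so `a = x ∈ R` is fixed; this
is the definition of `ringClassSubgroup`.) In particular the ring class subgroup does not depend on `jbar`.
[cite: Cox2013, §11.A Thm. 11.1] -/
theorem mem_ringClassSubgroup_iff_forall_smul_eq (hK : IsImaginaryQuadratic K)
    (jbar : AlgebraicClosure K →+* ℂ) {c : ℕ} (hc : c ≠ 0)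
    {R : IntermediateField K (AlgebraicClosure K)}
    (e : R ≃ₐ[K] ringClassField K (jbar.comp (algebraMap K (AlgebraicClosure K))) c)
    (σ : Field.absoluteGaloisGroup K) :
    σ ∈ ringClassSubgroup K c jbar ↔ ∀ x ∈ R, σ • x = x := by
  refine ⟨fun hσ x hx ↦ smul_eq_self_of_mem_ringClassSubgroup_of_algEquiv hK jbar hc e hσ hx, fun h ↦ ?_⟩
  simp only [ringClassSubgroup, Subgroup.mem_comap, Subgroup.mem_iInf, MulAction.mem_stabilizer_iff]
  intro a ha
  have haK : jbar a ∈ ringClassField K (jbar.comp (algebraMap K (AlgebraicClosure K))) c := by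
    refine ringClassSingularModuli_subset_ringClassField _ c ?_
    simp only [ringClassSingularModuli, Finset.mem_coe]
    rwa [mul_comm] at ha
  obtain ⟨x, hxR, hxa⟩ := exists_mem_apply_eq_of_mem_ringClassField_of_algEquiv hK jbar hc e haK
  have hxa' : x = a := jbar.injective hxa
  subst hxa'
  have h' : σ • x = x := h x hxR
  rwa [Field.absoluteGaloisGroup.smul_def] at h'

/-- **`ringClassSubgroup K c jbar` is the fixing subgroup of the class field**: for every class-field copy
`R ≅ K[c]` inside `K̄`, `ringClassSubgroup K c jbar = Gal(K̄/R)` (the fixing subgroup of `R`, pulled back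
along the identity `Γ_K = (K̄ ≃ₐ[K] K̄)`). [cite: Cox2013, §11.A Thm. 11.1] -/
theorem ringClassSubgroup_eq_comap_fixingSubgroup (hK : IsImaginaryQuadratic K)
    (jbar : AlgebraicClosure K →+* ℂ) {c : ℕ} (hc : c ≠ 0)
    {R : IntermediateField K (AlgebraicClosure K)}
    (e : R ≃ₐ[K] ringClassField K (jbar.comp (algebraMap K (AlgebraicClosure K))) c) :
    ringClassSubgroup K c jbar =
      R.fixingSubgroup.comap (Field.absoluteGaloisGroup.toAlgEquiv K).toMonoidHom := by
  ext σ
  rw [mem_ringClassSubgroup_iff_forall_smul_eq hK jbar hc e σ, Subgroup.mem_comap]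
  change _ ↔ σ ∈ (R.fixingSubgroup : Subgroup (Field.absoluteGaloisGroup K))
  rw [mem_fixingSubgroup_iff_forall_smul]
  exact ⟨fun h x ↦ h x x.2, fun h x hx ↦ h ⟨x, hx⟩⟩

/-! ## §2 Bauer: a splitting statement puts the layer `K_k` inside the class field of conductor `c` -/

/-- **Bauer's theorem for the layer `K_k`**: let `R ⊆ K̄` be finite Galois over `K` with the ring class
splitting law of conductor `c ≠ 0` (`v ∤ c` splits completely in `R` iff `[𝔭_v] = 1` in `I_K(c)/P_{K,ℤ}(c)`,
as produced by `exists_classField_algEquiv_ringClassField`). If all but finitely many primes `v` of `K` with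
`[𝔭_v] = 1` split completely in the `k`-th layer `K_k` of the `ℤ_p`-extension `κ`, then `K_k ⊆ R`
(Neukirch VII (13.9): `P(R|K) ⊆* P(K_k|K) ⟹ K_k ⊆ R`, the tree's `le_of_splitPrimes_subset_algClosure`).
[cite: NeukirchANT1999, Ch. VII Prop. (13.9)] [cite: Cox2013, §9.A Thm. 9.2] -/
theorem ZpExtension.layer_le_of_splitPrimes {p : ℕ} [Fact p.Prime] (κ : ZpExtension K p) (k : ℕ)
    {c : ℕ} (hc : c ≠ 0) {R : IntermediateField K (AlgebraicClosure K)} [FiniteDimensional K R]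
    [IsGalois K R]
    (hR : ∀ v : HeightOneSpectrum (𝓞 K), ¬ Ideal.span {((c : ℕ) : 𝓞 K)} ≤ v.asIdeal →
      (v ∈ splitPrimes K R ↔ primeClass c v = 1))
    (hsplit : ∀ᶠ v : HeightOneSpectrum (𝓞 K) in Filter.cofinite,
      primeClass c v = 1 → v ∈ splitPrimes K (κ.layer k)) :
    κ.layer k ≤ R := by
  haveI : PerfectField K := PerfectField.ofCharZero
  haveI : FiniteDimensional K (κ.layer k) := κ.finiteDimensional_layer_holds k
  haveI : IsGalois K (κ.layer k) := κ.isGalois_layer_holds k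
  have h𝔪 : Ideal.span {((c : ℕ) : 𝓞 K)} ≠ ⊥ := by
    rw [Ne, Ideal.span_singleton_eq_bot]
    exact_mod_cast hc
  have hev : ∀ᶠ v : HeightOneSpectrum (𝓞 K) in Filter.cofinite,
      ¬ Ideal.span {((c : ℕ) : 𝓞 K)} ≤ v.asIdeal := by
    rw [Filter.eventually_cofinite]
    simpa using finite_setOf_le_asIdeal h𝔪
  refine le_of_splitPrimes_subset_algClosure ((hsplit.and hev).mono fun v hv hvR ↦ ?_)
  exact hv.1 ((hR v hv.2).mp hvR)

/-! ## §3 Tower♯ from the splitting statement -/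

/-- **`Gal(K̄/K[c]) ≤ Gal(K̄/K_k)` from a splitting statement** (`K` imaginary quadratic, `c ≠ 0`, any
`jbar : K̄ → ℂ`, any `ℤ_p`-extension `κ`): if all but finitely many primes `v` of `K` with trivial ring class
`[𝔭_v] = 1 ∈ I_K(c)/P_{K,ℤ}(c)` split completely in `K_k`, then `ringClassSubgroup K c jbar ≤ κ.layerSubgroup k`,
i.e. `K_k ⊆ K[c]`. Proof: the class field `R ≅ K[c]` of conductor `c` (Cox Thm. 11.1,
`exists_classField_algEquiv_ringClassField`) contains `K_k` (Bauer, §2); `Gal(K̄/K[c])` fixes `R` (§1), hence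
`K_k`, pointwise; and the fixing subgroup of `K_k` is `κ⁻¹(p^kℤ_p)` (`ZpExtension.fixingSubgroup_layer`).
[cite: Cox2013, §11.A Thm. 11.1, §9.A Thm. 9.2] [cite: NeukirchANT1999, Ch. VII Prop. (13.9)]
[cite: PerrinRiou1987BSMF, §3.2] -/
theorem ringClassSubgroup_le_layerSubgroup_of_splitPrimes (hK : IsImaginaryQuadratic K) {p : ℕ}
    [Fact p.Prime] (κ : ZpExtension K p) (jbar : AlgebraicClosure K →+* ℂ) (k : ℕ) {c : ℕ} (hc : c ≠ 0)
    (hsplit : ∀ᶠ v : HeightOneSpectrum (𝓞 K) in Filter.cofinite,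
      primeClass c v = 1 → v ∈ splitPrimes K (κ.layer k)) :
    ringClassSubgroup K c jbar ≤ κ.layerSubgroup k := by
  haveI : PerfectField K := PerfectField.ofCharZero
  set ι : K →+* ℂ := jbar.comp (algebraMap K (AlgebraicClosure K)) with hι
  obtain ⟨R, hfd, hgal, -, hR, ⟨e⟩⟩ := exists_classField_algEquiv_ringClassField hK ι hc
  haveI := hfd
  haveI := hgal
  have hle : κ.layer k ≤ R := κ.layer_le_of_splitPrimes k hc hR hsplit
  intro σ hσ
  have hfix : ∀ x : κ.layer k, σ • (x : AlgebraicClosure K) = x := fun x ↦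
    smul_eq_self_of_mem_ringClassSubgroup_of_algEquiv hK jbar hc e hσ (hle x.2)
  have hmem : σ ∈ ((κ.layer k).fixingSubgroup : Subgroup (Field.absoluteGaloisGroup K)) :=
    (mem_fixingSubgroup_iff_forall_smul (κ.layer k) σ).mpr hfix
  change Field.absoluteGaloisGroup.toAlgEquiv K σ ∈ (κ.layer k).fixingSubgroup at hmem
  rw [κ.fixingSubgroup_layer k, Subgroup.mem_map_equiv] at hmem
  exact hmem

/-- The instance `c = p^{k+1}` of `ringClassSubgroup_le_layerSubgroup_of_splitPrimes`: **`K_k ⊆ K[p^{k+1}]`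
from the splitting of the primes with `[𝔭_v] = 1 ∈ I_K(p^{k+1})/P_{K,ℤ}(p^{k+1})` in `K_k`**.
[cite: Cox2013, §11.A Thm. 11.1, §9.A Thm. 9.2] [cite: NeukirchANT1999, Ch. VII Prop. (13.9)] -/
theorem ringClassSubgroup_pow_succ_le_layerSubgroup_of_splitPrimes (hK : IsImaginaryQuadratic K) {p : ℕ}
    [Fact p.Prime] (κ : ZpExtension K p) (jbar : AlgebraicClosure K →+* ℂ) (k : ℕ)
    (hsplit : ∀ᶠ v : HeightOneSpectrum (𝓞 K) in Filter.cofinite,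
      primeClass (p ^ (k + 1)) v = 1 → v ∈ splitPrimes K (κ.layer k)) :
    ringClassSubgroup K (p ^ (k + 1)) jbar ≤ κ.layerSubgroup k :=
  ringClassSubgroup_le_layerSubgroup_of_splitPrimes hK κ jbar k
    (pow_ne_zero _ (Fact.out : p.Prime).ne_zero) hsplit

/-- **The same in the principal-generator currency** (Cox §9.A: the primes of trivial ring class mod `c` are
the `𝔭 = α𝓞_K` with `α ≡ n (mod c𝓞_K)`, `n ∈ ℤ` prime to `c` — the tree's
`RingClass.exists_generator_of_primeClass_eq_one`): if every prime `v ∤ c` of `K` of the form `𝔭_v = (α)`,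
`α − n ∈ c𝓞_K`, `n ∈ ℤ` coprime to `c`, splits completely in `K_k`, then `Gal(K̄/K[c]) ≤ Gal(K̄/K_k)`.
[cite: Cox2013, §9.A Thm. 9.2 and §11.A Thm. 11.1] [cite: NeukirchANT1999, Ch. VII Prop. (13.9)] -/
theorem ringClassSubgroup_le_layerSubgroup_of_principal_splits (hK : IsImaginaryQuadratic K) {p : ℕ}
    [Fact p.Prime] (κ : ZpExtension K p) (jbar : AlgebraicClosure K →+* ℂ) (k : ℕ) {c : ℕ} (hc : c ≠ 0)
    (hsplit : ∀ (v : HeightOneSpectrum (𝓞 K)) (α : 𝓞 K) (n : ℤ),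
      ¬ Ideal.span {((c : ℕ) : 𝓞 K)} ≤ v.asIdeal → IsCoprime n (c : ℤ) → v.asIdeal = Ideal.span {α} →
      α - (n : 𝓞 K) ∈ Ideal.span {((c : ℕ) : 𝓞 K)} → v ∈ splitPrimes K (κ.layer k)) :
    ringClassSubgroup K c jbar ≤ κ.layerSubgroup k := by
  refine ringClassSubgroup_le_layerSubgroup_of_splitPrimes hK κ jbar k hc ?_
  have h𝔪 : Ideal.span {((c : ℕ) : 𝓞 K)} ≠ ⊥ := by
    rw [Ne, Ideal.span_singleton_eq_bot]
    exact_mod_cast hc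
  have hev : ∀ᶠ v : HeightOneSpectrum (𝓞 K) in Filter.cofinite,
      ¬ Ideal.span {((c : ℕ) : 𝓞 K)} ≤ v.asIdeal := by
    rw [Filter.eventually_cofinite]
    simpa using finite_setOf_le_asIdeal h𝔪
  refine hev.mono fun v hv h1 ↦ ?_
  obtain ⟨α, n, hn, hvα, hαn⟩ := exists_generator_of_primeClass_eq_one c hv h1
  exact hsplit v α n hv hn hvα hαn

/-- **`K_k ⊆ K[p^{k+1}]` in the principal-generator currency at `c = p^{k+1}`** — the form produced by the
idèlic computation: if every prime `v ∤ p` of `K` with `𝔭_v = (α)`, `p^{k+1} ∣ α − n`, `n ∈ ℤ`, `p ∤ n`,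
splits completely in `K_k`, then `ringClassSubgroup K (p^{k+1}) jbar ≤ κ.layerSubgroup k`.
[cite: Cox2013, §9.A Thm. 9.2 and §11.A Thm. 11.1] [cite: NeukirchANT1999, Ch. VII Prop. (13.9)] -/
theorem ringClassSubgroup_pow_succ_le_layerSubgroup_of_principal_splits (hK : IsImaginaryQuadratic K)
    {p : ℕ} [Fact p.Prime] (κ : ZpExtension K p) (jbar : AlgebraicClosure K →+* ℂ) (k : ℕ)
    (hsplit : ∀ (v : HeightOneSpectrum (𝓞 K)) (α : 𝓞 K) (n : ℤ), (p : 𝓞 K) ∉ v.asIdeal →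
      ¬ (p : ℤ) ∣ n → v.asIdeal = Ideal.span {α} → (p : 𝓞 K) ^ (k + 1) ∣ α - (n : 𝓞 K) →
      v ∈ splitPrimes K (κ.layer k)) :
    ringClassSubgroup K (p ^ (k + 1)) jbar ≤ κ.layerSubgroup k := by
  have hp : p.Prime := Fact.out
  refine ringClassSubgroup_le_layerSubgroup_of_principal_splits hK κ jbar k
    (pow_ne_zero _ hp.ne_zero) fun v α n hv hn hvα hαn ↦ hsplit v α n ?_ ?_ hvα ?_
  · -- `p ∉ 𝔭_v` since `p^{k+1} ∉ 𝔭_v`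
    intro hpv
    apply hv
    rw [Ideal.span_singleton_le_iff_mem, Nat.cast_pow]
    exact v.asIdeal.pow_mem_of_mem hpv (k + 1) k.succ_pos
  · -- `p ∤ n` since `n` is coprime to `p^{k+1}`
    intro hpn
    have hu : IsUnit (p : ℤ) :=
      hn.isUnit_of_dvd' hpn (by exact_mod_cast dvd_pow_self p k.succ_ne_zero)
    rcases Int.isUnit_iff.mp hu with h | h
    · exact hp.one_lt.ne' (by exact_mod_cast h)
    · have : (0 : ℤ) ≤ (p : ℤ) := Int.natCast_nonneg p
      omega
  · rwa [Ideal.mem_span_singleton, Nat.cast_pow] at hαn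

/-! ## §4 The letter of Tower♯ from the family of splitting statements -/

/-- **Tower♯ from splitting** — the letter of the routes' support item `AnticyclotomicTowerSharp` (= the
registered stub `stub_anticyclotomicTowerSharp` of the line «twins» on `PrintX10b.BeyondCarrierDepthX10b`),
`∀ K p (odd) (imaginary quadratic) κ (anticyclotomic) jbar k, Gal(K̄/K[p^{k+1}]) ≤ Gal(K̄/K_k)`, follows from
the corresponding family of SPLITTING STATEMENTS «for all but finitely many `v`, `[𝔭_v] = 1` in
`I_K(p^{k+1})/P_{K,ℤ}(p^{k+1})` ⟹ `v` splits completely in `K_k`» (the idèlic half — `κ(Frob_v) ∈ p^kℤ_p`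
for `𝔭_v = (α)`, `α ≡ a (mod p^{k+1}𝒪_K)`, `a ∈ ℤ`, via the anticyclotomic sign and
`1 + p^{k+1}𝒪_{K,p} = (1 + p𝒪_{K,p})^{p^k}` for odd `p` — is NOT proved here).
[cite: Cox2013, §7.D Thm. 7.24 and §11.A Thm. 11.1] [cite: PerrinRiou1987BSMF, §3.2]
[cite: CastellaGrossiLeeSkinner2022, §4.1 (d(k))] -/
theorem anticyclotomicTowerSharp_of_forall_splitPrimes
    (hsplit : ∀ (K : Type) [Field K] [NumberField K] (p : ℕ) [Fact p.Prime], Odd p →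
      IsImaginaryQuadratic K →
      ∀ (κ : ZpExtension K p), κ.IsAnticyclotomic → ∀ (k : ℕ),
      ∀ᶠ v : HeightOneSpectrum (𝓞 K) in Filter.cofinite,
        primeClass (p ^ (k + 1)) v = 1 → v ∈ splitPrimes K (κ.layer k)) :
    ∀ (K : Type) [Field K] [NumberField K] (p : ℕ) [Fact p.Prime], Odd p →
      IsImaginaryQuadratic K →
      ∀ (κ : ZpExtension K p), κ.IsAnticyclotomic →
      ∀ (jbar : AlgebraicClosure K →+* ℂ) (k : ℕ),
      ringClassSubgroup K (p ^ (k + 1)) jbar ≤ κ.layerSubgroup k := by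
  intro K _ _ p _ hp hK κ hκ jbar k
  exact ringClassSubgroup_pow_succ_le_layerSubgroup_of_splitPrimes hK κ jbar k (hsplit K p hp hK κ hκ k)

/-! ## §5 Independence of `jbar` (appended by bsd-line-x10b-p1 LEAD g10 after Tower♯ closed) -/

/-- **The ring class subgroup does not depend on the embedding `jbar : K̄ → ℂ`**: for `K` imaginary quadratic and
`c ≠ 0`, `ringClassSubgroup K c jbar = ringClassSubgroup K c jbar'` for any two embeddings. Proof: each is the fixing
subgroup of the class field of conductor `c` inside `K̄` (`ringClassSubgroup_eq_comap_fixingSubgroup`), and that class field is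
unique — two finite Galois `R, R' ⊆ K̄` with the ring class splitting law mod `c` coincide (Neukirch VII (13.10), the tree's
`RingClassField.eq_of_splitPrimes_iff_primeClass_eq_one`). [cite: Cox2013, §9.A (pp. 180–181) and §11.A Thm. 11.1]
[cite: NeukirchANT1999, Ch. VII Cor. (13.10)] -/
theorem ringClassSubgroup_eq_of_embeddings (hK : IsImaginaryQuadratic K) {c : ℕ} (hc : c ≠ 0)
    (jbar jbar' : AlgebraicClosure K →+* ℂ) :
    ringClassSubgroup K c jbar = ringClassSubgroup K c jbar' := by
  obtain ⟨R, hfd, hgal, -, hR, ⟨e⟩⟩ :=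
    exists_classField_algEquiv_ringClassField hK (jbar.comp (algebraMap K (AlgebraicClosure K))) hc
  obtain ⟨R', hfd', hgal', -, hR', ⟨e'⟩⟩ :=
    exists_classField_algEquiv_ringClassField hK (jbar'.comp (algebraMap K (AlgebraicClosure K))) hc
  haveI := hfd
  haveI := hgal
  haveI := hfd'
  haveI := hgal'
  have hRR' : R = R' := eq_of_splitPrimes_iff_primeClass_eq_one c hc hR hR'
  subst hRR'
  rw [ringClassSubgroup_eq_comap_fixingSubgroup hK jbar hc e, ringClassSubgroup_eq_comap_fixingSubgroup hK jbar' hc e']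

/-- **`ringClassSubgroup K c jbar` is the fixing subgroup of THE class field of conductor `c`** in the splitting-law
currency: for every finite Galois `R ⊆ K̄` in which a prime `v ∤ c` splits completely iff `[𝔭_v] = 1` in `I_K(c)/P_{K,ℤ}(c)`,
`ringClassSubgroup K c jbar = Gal(K̄/R)` — no isomorphism with `K[c] ⊂ ℂ` needs to be supplied (it exists by Cox Thm. 11.1,
`exists_classField_algEquiv_ringClassField`, and `R` is unique by Neukirch VII (13.10)).
[cite: Cox2013, §11.A Thm. 11.1 and §9.A Thm. 9.2] [cite: NeukirchANT1999, Ch. VII Cor. (13.10)] -/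
theorem ringClassSubgroup_eq_comap_fixingSubgroup_of_splitPrimes_iff (hK : IsImaginaryQuadratic K) {c : ℕ} (hc : c ≠ 0)
    (jbar : AlgebraicClosure K →+* ℂ) {R : IntermediateField K (AlgebraicClosure K)} [FiniteDimensional K R] [IsGalois K R]
    (hR : ∀ v : HeightOneSpectrum (𝓞 K), ¬ Ideal.span {((c : ℕ) : 𝓞 K)} ≤ v.asIdeal →
      (v ∈ splitPrimes K R ↔ primeClass c v = 1)) :
    ringClassSubgroup K c jbar =
      R.fixingSubgroup.comap (Field.absoluteGaloisGroup.toAlgEquiv K).toMonoidHom := by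
  obtain ⟨R', hfd', hgal', -, hR', ⟨e'⟩⟩ :=
    exists_classField_algEquiv_ringClassField hK (jbar.comp (algebraMap K (AlgebraicClosure K))) hc
  haveI := hfd'
  haveI := hgal'
  have hRR' : R' = R := eq_of_splitPrimes_iff_primeClass_eq_one c hc hR' hR
  subst hRR'
  exact ringClassSubgroup_eq_comap_fixingSubgroup hK jbar hc e'

/-- **Membership form**: with `R` the class field of conductor `c` (splitting-law currency), `σ ∈ ringClassSubgroup K c jbar`
iff `σ` fixes `R` pointwise. [cite: Cox2013, §11.A Thm. 11.1 and §9.A Thm. 9.2] [cite: NeukirchANT1999, Ch. VII Cor. (13.10)] -/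
theorem mem_ringClassSubgroup_iff_forall_smul_eq_of_splitPrimes_iff (hK : IsImaginaryQuadratic K) {c : ℕ} (hc : c ≠ 0)
    (jbar : AlgebraicClosure K →+* ℂ) {R : IntermediateField K (AlgebraicClosure K)} [FiniteDimensional K R] [IsGalois K R]
    (hR : ∀ v : HeightOneSpectrum (𝓞 K), ¬ Ideal.span {((c : ℕ) : 𝓞 K)} ≤ v.asIdeal →
      (v ∈ splitPrimes K R ↔ primeClass c v = 1)) (σ : Field.absoluteGaloisGroup K) :
    σ ∈ ringClassSubgroup K c jbar ↔ ∀ x ∈ R, σ • x = x := by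
  rw [ringClassSubgroup_eq_comap_fixingSubgroup_of_splitPrimes_iff hK hc jbar hR, Subgroup.mem_comap]
  change σ ∈ (R.fixingSubgroup : Subgroup (Field.absoluteGaloisGroup K)) ↔ _
  rw [mem_fixingSubgroup_iff_forall_smul]
  exact ⟨fun h x hx ↦ h ⟨x, hx⟩, fun h x ↦ h x x.2⟩

end Literature.NumberTheory.EllipticCurves

end
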